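import Summits.CriticalPhenomena.PercolationContinuityZ3.Theorems.PercNearOneGluingNoHeavyLowerTailSahiGridPatternLiteralTwoAbsorb

/-!
# `NoHeavyLowerTail` (crux stmt-CriticalPhenomena-4575), Sahi programme P1: **LITERAL ABSORPTION WITH CERTIFICATES — the core identity**,
# condition (N), every-dimension goodness, and the three-block star as a corollary

Support file (Sahi cell, seat `prim-sahi-p1`, generation 22; `--supports stmt-CriticalPhenomena-4575`).  Pure proofs, no definitions,
no `sorry`, standard axioms.  Continuation of `…SahiGridPatternLiteralTwoAbsorb` (setting, certificate and the statement of the identity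
are in that file's header): here the CORE INEQUALITY `0 ≤ [sStarD (X∪Y) A A' − Φ(A∩A')] + Σ_{A∩A'} δ` is proved (`litAbsorb_core`: the
pair-sum part of the literal-absorption identity is a polynomial identity in 21 indeterminates after 6-fold symmetrisation — `ring` —, the
single-sum part cancels pointwise, and the ten families are nonnegative: coefficientwise Harris ×4, fibre Kleitman, the inner certificate's
condition (N) at the two off-diagonal section pairs, `Σ d'·D₀₁`, `2^k Σ 1_{U'}(D₀₂+D₁₂)`, and the `Q_E` products), whence condition (N)
(`litAbsorb_cert_N`), **`sStarD_cylSet_litAbsorb_nonneg`** (`{ξ=2} ∪ cyl U'` is a good first slot in every dimension whenever `U'` has a diagonal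
certificate) and, feeding in the pair certificate of a two-orthant union (`…TwoOrthant`, `…TwoOrthantTop`, `pairCert_T`),
**`sStarD_cylSet_threeStar_nonneg`**: the three-block star `{ξ = 2} ∪ {p = 2} ∪ {t ≥ b}` (`b ∈ {1,2}^k`, `k ≥ 1`) is good in every dimension.
Nothing here asserts `PatternPos d` for `d ≥ 4`. [this work]
-/

namespace Summit.CriticalPhenomena.PercolationContinuityZ3.Theorems.SahiGridPattern

open Finset SahiGrid3
open scoped BigOperators

variable {k : ℕ}

set_option maxHeartbeats 4000000 in
/-- **THE CORE INEQUALITY OF LITERAL ABSORPTION** (every `k`, every up-set `U'` with a diagonal certificate `d'`): for all up-sets `A, A'`,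
`0 ≤ [sStarD (X∪Y) A A' − Φ(A∩A')] + Σ_{x∈A∩A'} [ξ(x) ≠ 2](d'(z(x)) − 2^k 1_{U'}(z(x)))`.  Proof: the identity of the file header — pair-sum part by
6-fold symmetrisation and `ring`, single-sum part pointwise — and the nonnegativity of its ten families. [this work] -/
theorem litAbsorb_core (ℓ : Pd 1) (hℓ : ℓ 0 = 2) {U' : Finset (Pd k)} (hU' : IsUpperSet (U' : Set (Pd k))) (d' : Pd k → ℤ)
    (hd' : ∀ z, 0 ≤ d' z)
    (hN' : ∀ P Q : Finset (Pd k), IsUpperSet (P : Set (Pd k)) → IsUpperSet (Q : Set (Pd k)) →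
      (∑ q ∈ P, ∑ r ∈ Q, thetaVal U' q r) ≤ ∑ z ∈ P ∩ Q, d' z)
    {X Y : Finset (Pd (1 + k))}
    (hX : ∀ ξ z, glue ξ z ∈ X ↔ ξ ∈ (univ.filter fun y : Pd 1 => ∀ j, ℓ j ≤ y j)) (hY : ∀ ξ z, glue ξ z ∈ Y ↔ z ∈ U') :
    ∀ A A' : Finset (Pd (1 + k)), IsUpperSet (A : Set (Pd (1 + k))) → IsUpperSet (A' : Set (Pd (1 + k))) →
      0 ≤ (sStarD (X ∪ Y) A A'
        - (2 ^ k * (∑ z : Pd k, (1 - ind U' z) * ∑ ξ : Pd 1, ind (fibre (A ∩ A') z) ξ * (2 ^ 1 * ind (univ.filter fun y : Pd 1 => ∀ j, ℓ j ≤ y j) ξ - (nuCount (univ.filter fun y : Pd 1 => ∀ j, ℓ j ≤ y j) ξ : ℤ)))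
          + (∑ ξ : Pd 1, (1 - ind (univ.filter fun y : Pd 1 => ∀ j, ℓ j ≤ y j) ξ) * (2 ^ 1 - (nuCount (univ.filter fun y : Pd 1 => ∀ j, ℓ j ≤ y j) ξ : ℤ)) *
              ∑ z : Pd k, ind (sect (A ∩ A') ξ) z * (2 ^ k * ind U' z - (nuCount U' z : ℤ)))))
        + ∑ x ∈ A ∩ A', (1 - ind X x) * (d' (cellOf x) - 2 ^ k * ind U' (cellOf x)) := by
  intro A A' hA hA'
  obtain ⟨i0, i1, i2⟩ := ind_literalTwo_vals ℓ hℓ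
  obtain ⟨-, -, -, -, -, -, -, -, -, t01, t02, t10, t12, t20, t21⟩ := pd1_facts
  -- the `δ`-sum with the literal axis explicit
  have eδ : (∑ x ∈ A ∩ A', (1 - ind X x) * (d' (cellOf x) - 2 ^ k * ind U' (cellOf x)))
      = ∑ z : Pd k, (ind A (glue (fun _ => 0) z) * ind A' (glue (fun _ => 0) z) + ind A (glue (fun _ => 1) z) * ind A' (glue (fun _ => 1) z)) * (d' z - 2 ^ k * ind U' z) := by
    rw [sum_mem_eq_sum_ind_mul, sum_glue, sum_pd1]
    simp only [cellOf_glue, ind_inter_eq_mul, (ind_free_literalTwo_vals ℓ hℓ hX _).1, (ind_free_literalTwo_vals ℓ hℓ hX _).2.1,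
      (ind_free_literalTwo_vals ℓ hℓ hX _).2.2]
    have hz : (∑ z : Pd k, ind A (glue (fun _ => 2) z) * ind A' (glue (fun _ => 2) z) * ((1 - 1) * (d' z - 2 ^ k * ind U' z))) = 0 :=
      Finset.sum_eq_zero fun z _ => by ring
    rw [hz, add_zero, ← Finset.sum_add_distrib]
    refine Finset.sum_congr rfl fun z _ => ?_
    ring
  rw [eδ, sStarD_union_sub_pairCertSlack_eq_pairSum hX hY A A']
  set L : Finset (Pd 1) := (univ.filter fun y : Pd 1 => ∀ j, ℓ j ≤ y j) with hL
  have e4 := pairSum3_pd1_explicit (m := k) (fun (ξ η : Pd 1) (z z' : Pd k) =>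
      ( 2 * (ind L ξ + ind U' z - ind L ξ * ind U' z) * ind A (glue ξ z) * ind A' (glue ξ z)
        - (ind L ξ + ind U' z - ind L ξ * ind U' z) * ind A (glue η z') * ind A' (glue η z')
        - ind A (glue ξ z) * (ind L η + ind U' z' - ind L η * ind U' z') * ind A' (glue η z')
        - ind A' (glue ξ z) * (ind L η + ind U' z' - ind L η * ind U' z') * ind A (glue η z')
        + ind A (glue ξ z) * ind A' (glue η z')
            * (ind L (thirdPt ξ η) + ind U' (thirdPt z z') - ind L (thirdPt ξ η) * ind U' (thirdPt z z'))
        - ind A (glue ξ z) * ind A' (glue ξ z)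
            * ((1 - ind U' z) * (ind L ξ - ind L η) + (1 - ind L ξ) * (1 - ind L η) * (ind U' z - ind U' z')) ))
  rw [e4]
  simp only [t01, t02, t10, t12, t20, t21, i0, i1, i2]
  -- the clean kernels
  set pL : Pd k → Pd k → Pd k → ℤ := fun z z' z'' =>
      ind A (glue (fun _ => 0) z) * ind A' (glue (fun _ => 0) z) + ind A (glue (fun _ => 0) z) * ind A' (glue (fun _ => 1) z')
      - ind A (glue (fun _ => 0) z) * ind A' (glue (fun _ => 2) z') - ind A (glue (fun _ => 0) z') * ind A' (glue (fun _ => 0) z')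
      + ind A (glue (fun _ => 1) z) * ind A' (glue (fun _ => 0) z') + ind A (glue (fun _ => 1) z) * ind A' (glue (fun _ => 1) z)
      - ind A (glue (fun _ => 1) z) * ind A' (glue (fun _ => 2) z') - ind A (glue (fun _ => 1) z') * ind A' (glue (fun _ => 1) z')
      + 2 * ind A (glue (fun _ => 2) z) * ind A' (glue (fun _ => 2) z) - ind A (glue (fun _ => 2) z') * ind A' (glue (fun _ => 0) z)
      - ind A (glue (fun _ => 2) z') * ind A' (glue (fun _ => 1) z) + ind A (glue (fun _ => 0) z) * ind A' (glue (fun _ => 0) z) * ind U' z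
      + ind A (glue (fun _ => 0) z) * ind A' (glue (fun _ => 0) z) * ind U' z' - ind A (glue (fun _ => 0) z) * ind A' (glue (fun _ => 1) z') * ind U' z'
      + ind A (glue (fun _ => 0) z) * ind A' (glue (fun _ => 2) z') * ind U' z'' - ind A (glue (fun _ => 0) z') * ind A' (glue (fun _ => 0) z') * ind U' z
      - ind A (glue (fun _ => 0) z') * ind A' (glue (fun _ => 1) z) * ind U' z' - ind A (glue (fun _ => 0) z') * ind A' (glue (fun _ => 2) z) * ind U' z'
      - ind A (glue (fun _ => 1) z) * ind A' (glue (fun _ => 0) z') * ind U' z' + ind A (glue (fun _ => 1) z) * ind A' (glue (fun _ => 1) z) * ind U' z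
      + ind A (glue (fun _ => 1) z) * ind A' (glue (fun _ => 1) z) * ind U' z' + ind A (glue (fun _ => 1) z) * ind A' (glue (fun _ => 2) z') * ind U' z''
      - ind A (glue (fun _ => 1) z') * ind A' (glue (fun _ => 0) z) * ind U' z' - ind A (glue (fun _ => 1) z') * ind A' (glue (fun _ => 1) z') * ind U' z
      - ind A (glue (fun _ => 1) z') * ind A' (glue (fun _ => 2) z) * ind U' z' - ind A (glue (fun _ => 2) z) * ind A' (glue (fun _ => 0) z') * ind U' z'
      + ind A (glue (fun _ => 2) z) * ind A' (glue (fun _ => 0) z') * ind U' z'' - ind A (glue (fun _ => 2) z) * ind A' (glue (fun _ => 1) z') * ind U' z'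
      + ind A (glue (fun _ => 2) z) * ind A' (glue (fun _ => 1) z') * ind U' z''
      + 2 * ind A (glue (fun _ => 2) z) * ind A' (glue (fun _ => 2) z) * ind U' z
      - 2 * ind A (glue (fun _ => 2) z') * ind A' (glue (fun _ => 2) z') * ind U' z with hpL
  set pR : Pd k → Pd k → Pd k → ℤ := fun z z' z'' =>
      ind A (glue (fun _ => 0) z) * ind A' (glue (fun _ => 1) z') - ind A (glue (fun _ => 0) z) * ind A' (glue (fun _ => 2) z')
      + ind A (glue (fun _ => 1) z) * ind A' (glue (fun _ => 0) z') - ind A (glue (fun _ => 1) z) * ind A' (glue (fun _ => 2) z')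
      - ind A (glue (fun _ => 2) z) * ind A' (glue (fun _ => 0) z') - ind A (glue (fun _ => 2) z) * ind A' (glue (fun _ => 1) z')
      + 2 * ind A (glue (fun _ => 2) z) * ind A' (glue (fun _ => 2) z') + 2 * ind A (glue (fun _ => 2) z') * ind A' (glue (fun _ => 2) z')
      - 2 * ind A (glue (fun _ => 2) z') * ind A' (glue (fun _ => 2) z'') + ind A (glue (fun _ => 0) z) * ind A' (glue (fun _ => 0) z) * ind U' z
      - ind A (glue (fun _ => 0) z) * ind A' (glue (fun _ => 1) z') * ind U' z - ind A (glue (fun _ => 0) z) * ind A' (glue (fun _ => 1) z') * ind U' z'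
      + ind A (glue (fun _ => 0) z) * ind A' (glue (fun _ => 2) z') * ind U' z'' - ind A (glue (fun _ => 0) z') * ind A' (glue (fun _ => 2) z) * ind U' z'
      - ind A (glue (fun _ => 1) z) * ind A' (glue (fun _ => 0) z') * ind U' z - ind A (glue (fun _ => 1) z) * ind A' (glue (fun _ => 0) z') * ind U' z'
      + ind A (glue (fun _ => 1) z) * ind A' (glue (fun _ => 1) z) * ind U' z + ind A (glue (fun _ => 1) z) * ind A' (glue (fun _ => 2) z') * ind U' z''
      - ind A (glue (fun _ => 1) z') * ind A' (glue (fun _ => 2) z) * ind U' z' - ind A (glue (fun _ => 2) z) * ind A' (glue (fun _ => 0) z') * ind U' z'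
      + ind A (glue (fun _ => 2) z) * ind A' (glue (fun _ => 0) z') * ind U' z'' - ind A (glue (fun _ => 2) z) * ind A' (glue (fun _ => 1) z') * ind U' z'
      + ind A (glue (fun _ => 2) z) * ind A' (glue (fun _ => 1) z') * ind U' z''
      + 2 * ind A (glue (fun _ => 2) z) * ind A' (glue (fun _ => 2) z) * ind U' z
      - 2 * ind A (glue (fun _ => 2) z) * ind A' (glue (fun _ => 2) z') * ind U' z''
      - 2 * ind A (glue (fun _ => 2) z') * ind A' (glue (fun _ => 2) z') * ind U' z
      + 2 * ind A (glue (fun _ => 2) z') * ind A' (glue (fun _ => 2) z'') * ind U' z with hpR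
  set pL6 : Pd k → Pd k → Pd k → ℤ := fun z z' z'' =>
      ind A (glue (fun _ => 0) z) * ind A' (glue (fun _ => 0) z) + ind A (glue (fun _ => 0) z) * ind A' (glue (fun _ => 1) z')
      - ind A (glue (fun _ => 0) z) * ind A' (glue (fun _ => 2) z') - ind A (glue (fun _ => 0) z') * ind A' (glue (fun _ => 0) z')
      + ind A (glue (fun _ => 1) z) * ind A' (glue (fun _ => 0) z') + ind A (glue (fun _ => 1) z) * ind A' (glue (fun _ => 1) z)
      - ind A (glue (fun _ => 1) z) * ind A' (glue (fun _ => 2) z') - ind A (glue (fun _ => 1) z') * ind A' (glue (fun _ => 1) z')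
      + 2 * ind A (glue (fun _ => 2) z) * ind A' (glue (fun _ => 2) z) - ind A (glue (fun _ => 2) z') * ind A' (glue (fun _ => 0) z)
      - ind A (glue (fun _ => 2) z') * ind A' (glue (fun _ => 1) z) + 2 * ind A (glue (fun _ => 0) z) * ind A' (glue (fun _ => 0) z) * ind U' z
      + ind A (glue (fun _ => 0) z) * ind A' (glue (fun _ => 0) z) * ind U' z' - ind A (glue (fun _ => 0) z) * ind A' (glue (fun _ => 1) z') * ind U' z'
      + ind A (glue (fun _ => 0) z) * ind A' (glue (fun _ => 2) z') * ind U' z'' - ind A (glue (fun _ => 0) z') * ind A' (glue (fun _ => 0) z') * ind U' z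
      - ind A (glue (fun _ => 0) z') * ind A' (glue (fun _ => 1) z) * ind U' z' - ind A (glue (fun _ => 0) z') * ind A' (glue (fun _ => 2) z) * ind U' z'
      - ind A (glue (fun _ => 1) z) * ind A' (glue (fun _ => 0) z') * ind U' z' + 2 * ind A (glue (fun _ => 1) z) * ind A' (glue (fun _ => 1) z) * ind U' z
      + ind A (glue (fun _ => 1) z) * ind A' (glue (fun _ => 1) z) * ind U' z' + ind A (glue (fun _ => 1) z) * ind A' (glue (fun _ => 2) z') * ind U' z''
      - ind A (glue (fun _ => 1) z') * ind A' (glue (fun _ => 0) z) * ind U' z' - ind A (glue (fun _ => 1) z') * ind A' (glue (fun _ => 1) z') * ind U' z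
      - ind A (glue (fun _ => 1) z') * ind A' (glue (fun _ => 2) z) * ind U' z' - ind A (glue (fun _ => 2) z) * ind A' (glue (fun _ => 0) z') * ind U' z'
      + ind A (glue (fun _ => 2) z) * ind A' (glue (fun _ => 0) z') * ind U' z'' - ind A (glue (fun _ => 2) z) * ind A' (glue (fun _ => 1) z') * ind U' z'
      + ind A (glue (fun _ => 2) z) * ind A' (glue (fun _ => 1) z') * ind U' z''
      + 2 * ind A (glue (fun _ => 2) z) * ind A' (glue (fun _ => 2) z) * ind U' z
      - 2 * ind A (glue (fun _ => 2) z') * ind A' (glue (fun _ => 2) z') * ind U' z with hpL6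
  -- the families
  have dA : ∀ (s : Pd k) (i j : Fin 3), i ≤ j → 0 ≤ ind A (glue (fun _ => j) s) - ind A (glue (fun _ => i) s) := by
    intro s i j hij
    have hle : glue (fun _ => i : Pd 1) s ≤ glue (fun _ => j) s := glue_le_glue_iff.2 ⟨fun _ => hij, le_rfl⟩
    linarith [ind_le_ind_of_imp (S := A) (T := A) (fun h => hA hle h)]
  have dA' : ∀ (s : Pd k) (i j : Fin 3), i ≤ j → 0 ≤ ind A' (glue (fun _ => j) s) - ind A' (glue (fun _ => i) s) := by
    intro s i j hij
    have hle : glue (fun _ => i : Pd 1) s ≤ glue (fun _ => j) s := glue_le_glue_iff.2 ⟨fun _ => hij, le_rfl⟩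
    linarith [ind_le_ind_of_imp (S := A') (T := A') (fun h => hA' hle h)]
  have hsA : ∀ ξ : Pd 1, IsUpperSet ((sect A ξ : Finset (Pd k)) : Set (Pd k)) := fun ξ => isUpperSet_sect hA ξ
  have hsA' : ∀ ξ : Pd 1, IsUpperSet ((sect A' ξ : Finset (Pd k)) : Set (Pd k)) := fun ξ => isUpperSet_sect hA' ξ
  have F1 : 0 ≤ ∑ z : Pd k, ∑ z' : Pd k, (if TotDist z z' = true then (1:ℤ) else 0) * (ind A (glue (fun _ => 2) z) * (ind A' (glue (fun _ => 0) z) * ind U' z - ind A' (glue (fun _ => 0) z') * ind U' z')) := by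
    have h := pairKernel_harris_nonneg (sect A (fun _ => 2)) (sect A' (fun _ => 0) ∩ U') (hsA _) (isUpperSet_inter_coe (hsA' _) hU')
    simp only [ind_inter_eq_mul, ind_sect] at h
    refine le_of_le_of_eq h ?_
    exact Finset.sum_congr rfl fun z _ => Finset.sum_congr rfl fun z' _ => by ring
  have F2 : 0 ≤ ∑ z : Pd k, ∑ z' : Pd k, (if TotDist z z' = true then (1:ℤ) else 0) * (ind A (glue (fun _ => 2) z) * (ind A' (glue (fun _ => 1) z) * ind U' z - ind A' (glue (fun _ => 1) z') * ind U' z')) := by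
    have h := pairKernel_harris_nonneg (sect A (fun _ => 2)) (sect A' (fun _ => 1) ∩ U') (hsA _) (isUpperSet_inter_coe (hsA' _) hU')
    simp only [ind_inter_eq_mul, ind_sect] at h
    refine le_of_le_of_eq h ?_
    exact Finset.sum_congr rfl fun z _ => Finset.sum_congr rfl fun z' _ => by ring
  have F3 : 0 ≤ ∑ z : Pd k, ∑ z' : Pd k, (if TotDist z z' = true then (1:ℤ) else 0) * (ind A' (glue (fun _ => 2) z) * (ind A (glue (fun _ => 0) z) * ind U' z - ind A (glue (fun _ => 0) z') * ind U' z')) := by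
    have h := pairKernel_harris_nonneg (sect A' (fun _ => 2)) (sect A (fun _ => 0) ∩ U') (hsA' _) (isUpperSet_inter_coe (hsA _) hU')
    simp only [ind_inter_eq_mul, ind_sect] at h
    refine le_of_le_of_eq h ?_
    exact Finset.sum_congr rfl fun z _ => Finset.sum_congr rfl fun z' _ => by ring
  have F4 : 0 ≤ ∑ z : Pd k, ∑ z' : Pd k, (if TotDist z z' = true then (1:ℤ) else 0) * (ind A' (glue (fun _ => 2) z) * (ind A (glue (fun _ => 1) z) * ind U' z - ind A (glue (fun _ => 1) z') * ind U' z')) := by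
    have h := pairKernel_harris_nonneg (sect A' (fun _ => 2)) (sect A (fun _ => 1) ∩ U') (hsA' _) (isUpperSet_inter_coe (hsA _) hU')
    simp only [ind_inter_eq_mul, ind_sect] at h
    refine le_of_le_of_eq h ?_
    exact Finset.sum_congr rfl fun z _ => Finset.sum_congr rfl fun z' _ => by ring
  have F5 : 0 ≤ ∑ z : Pd k, ∑ z' : Pd k, (if TotDist z z' = true then (1:ℤ) else 0) * ((1 - ind U' z) * ind A (glue (fun _ => 2) z') * (ind A' (glue (fun _ => 2) z') - ind A' (glue (fun _ => 2) (thirdPt z z')))) := by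
    have h := pairKernel_kleitman_nonneg (univ \ U') (sect A (fun _ => 2)) (sect A' (fun _ => 2)) (hsA _) (hsA' _)
    simp only [ind_sdiff_univ, ind_sect] at h
    refine le_of_le_of_eq h ?_
    exact Finset.sum_congr rfl fun z _ => Finset.sum_congr rfl fun z' _ => by ring
  have F6 : (∑ z : Pd k, ∑ z' : Pd k, (if TotDist z z' = true then (1:ℤ) else 0) * (ind A (glue (fun _ => 0) z) * ind A' (glue (fun _ => 1) z') * (ind U' z + ind U' z' - ind U' (thirdPt z z'))))
      ≤ ∑ z : Pd k, ind A (glue (fun _ => 0) z) * ind A' (glue (fun _ => 1) z) * d' z := by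
    have h := hN' (sect A (fun _ => 0)) (sect A' (fun _ => 1)) (hsA _) (hsA' _)
    rw [sum_mem_eq_sum_ind_mul (sect A (fun _ => 0)), sum_mem_eq_sum_ind_mul (sect A (fun _ => 0) ∩ sect A' (fun _ => 1))] at h
    simp only [sum_mem_eq_sum_ind_mul (sect A' (fun _ => 1)), Finset.mul_sum] at h
    simp only [ind_inter_eq_mul, ind_sect, thetaVal_eq_ite_mul] at h
    refine le_of_eq_of_le ?_ (le_of_le_of_eq h ?_)
    · exact Finset.sum_congr rfl fun z _ => Finset.sum_congr rfl fun z' _ => by ring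
    · exact Finset.sum_congr rfl fun z _ => by ring
  have F7 : (∑ z : Pd k, ∑ z' : Pd k, (if TotDist z z' = true then (1:ℤ) else 0) * (ind A (glue (fun _ => 1) z) * ind A' (glue (fun _ => 0) z') * (ind U' z + ind U' z' - ind U' (thirdPt z z'))))
      ≤ ∑ z : Pd k, ind A (glue (fun _ => 1) z) * ind A' (glue (fun _ => 0) z) * d' z := by
    have h := hN' (sect A (fun _ => 1)) (sect A' (fun _ => 0)) (hsA _) (hsA' _)
    rw [sum_mem_eq_sum_ind_mul (sect A (fun _ => 1)), sum_mem_eq_sum_ind_mul (sect A (fun _ => 1) ∩ sect A' (fun _ => 0))] at h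
    simp only [sum_mem_eq_sum_ind_mul (sect A' (fun _ => 0)), Finset.mul_sum] at h
    simp only [ind_inter_eq_mul, ind_sect, thetaVal_eq_ite_mul] at h
    refine le_of_eq_of_le ?_ (le_of_le_of_eq h ?_)
    · exact Finset.sum_congr rfl fun z _ => Finset.sum_congr rfl fun z' _ => by ring
    · exact Finset.sum_congr rfl fun z _ => by ring
  have T1 : 0 ≤ ∑ z : Pd k, d' z * ((ind A (glue (fun _ => 1) z) - ind A (glue (fun _ => 0) z)) * (ind A' (glue (fun _ => 1) z) - ind A' (glue (fun _ => 0) z))) :=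
    Finset.sum_nonneg fun z _ => mul_nonneg (hd' z) (mul_nonneg (dA z 0 1 (by decide)) (dA' z 0 1 (by decide)))
  have T2 : 0 ≤ ∑ z : Pd k, ∑ z' : Pd k, (if TotDist z z' = true then (1:ℤ) else 0) * (ind U' z * ((ind A (glue (fun _ => 2) z) - ind A (glue (fun _ => 0) z)) * (ind A' (glue (fun _ => 2) z) - ind A' (glue (fun _ => 0) z))
      + (ind A (glue (fun _ => 2) z) - ind A (glue (fun _ => 1) z)) * (ind A' (glue (fun _ => 2) z) - ind A' (glue (fun _ => 1) z)))) :=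
    Finset.sum_nonneg fun z _ => Finset.sum_nonneg fun z' _ => mul_nonneg (by split_ifs <;> norm_num)
      (mul_nonneg (ind_nonneg' U' z) (add_nonneg (mul_nonneg (dA z 0 2 (by decide)) (dA' z 0 2 (by decide)))
        (mul_nonneg (dA z 1 2 (by decide)) (dA' z 1 2 (by decide)))))
  have T3 : 0 ≤ ∑ z : Pd k, ∑ z' : Pd k, (if TotDist z z' = true then (1:ℤ) else 0) * ((1 - ind U' (thirdPt z z')) * ((ind A (glue (fun _ => 2) z) - ind A (glue (fun _ => 0) z)) * (ind A' (glue (fun _ => 2) z') - ind A' (glue (fun _ => 1) z'))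
      + (ind A (glue (fun _ => 2) z) - ind A (glue (fun _ => 1) z)) * (ind A' (glue (fun _ => 2) z') - ind A' (glue (fun _ => 0) z')))) :=
    Finset.sum_nonneg fun z _ => Finset.sum_nonneg fun z' _ => mul_nonneg (by split_ifs <;> norm_num)
      (mul_nonneg (by linarith [ind_le_one' U' (thirdPt z z')]) (add_nonneg (mul_nonneg (dA z 0 2 (by decide)) (dA' z' 1 2 (by decide)))
        (mul_nonneg (dA z 1 2 (by decide)) (dA' z' 0 2 (by decide)))))
  -- the single-sum part: `2^k Σ (a_0 a'_0 + a_1 a'_1) 1_{U'}` as a pair sum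
  have E2 : (∑ z : Pd k, (ind A (glue (fun _ => 0) z) * ind A' (glue (fun _ => 0) z) + ind A (glue (fun _ => 1) z) * ind A' (glue (fun _ => 1) z)) * (d' z - 2 ^ k * ind U' z))
      = (∑ z : Pd k, ind A (glue (fun _ => 0) z) * ind A' (glue (fun _ => 1) z) * d' z) + (∑ z : Pd k, ind A (glue (fun _ => 1) z) * ind A' (glue (fun _ => 0) z) * d' z)
        + (∑ z : Pd k, d' z * ((ind A (glue (fun _ => 1) z) - ind A (glue (fun _ => 0) z)) * (ind A' (glue (fun _ => 1) z) - ind A' (glue (fun _ => 0) z))))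
        - ∑ z : Pd k, ∑ z' : Pd k, (if TotDist z z' = true then (1:ℤ) else 0) * ((ind A (glue (fun _ => 0) z) * ind A' (glue (fun _ => 0) z) + ind A (glue (fun _ => 1) z) * ind A' (glue (fun _ => 1) z)) * ind U' z) := by
    rw [← Finset.sum_add_distrib, ← Finset.sum_add_distrib, ← Finset.sum_sub_distrib]
    refine Finset.sum_congr rfl fun z _ => ?_
    rw [← Finset.sum_mul, sum_ite_totDist_eq_two_pow z]
    ring
  -- the pair-sum part: symmetrised kernel identity
  have hsym : ∀ z z' z'' : Pd k, pL z z' z'' + pL z z'' z' + pL z' z z'' + pL z' z'' z + pL z'' z z' + pL z'' z' z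
      = pR z z' z'' + pR z z'' z' + pR z' z z'' + pR z' z'' z + pR z'' z z' + pR z'' z' z := by
    intro z z' z''
    simp only [hpL, hpR]
    ring
  have k3 : (∑ z : Pd k, ∑ z' : Pd k, (if TotDist z z' = true then (1:ℤ) else 0) * pL z z' (thirdPt z z'))
      = ∑ z : Pd k, ∑ z' : Pd k, (if TotDist z z' = true then (1:ℤ) else 0) * pR z z' (thirdPt z z') := by
    have h6 : 6 * (∑ z : Pd k, ∑ z' : Pd k, (if TotDist z z' = true then (1:ℤ) else 0) * pL z z' (thirdPt z z'))
        = 6 * (∑ z : Pd k, ∑ z' : Pd k, (if TotDist z z' = true then (1:ℤ) else 0) * pR z z' (thirdPt z z')) := by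
      rw [pairSum_sym6 pL, pairSum_sym6 pR]
      exact Finset.sum_congr rfl fun z _ => Finset.sum_congr rfl fun z' _ => by rw [hsym]
    exact mul_left_cancel₀ (by norm_num : (6:ℤ) ≠ 0) h6
  -- right kernel = the nine pair-sum families
  have k2 : (∑ z : Pd k, ∑ z' : Pd k, (if TotDist z z' = true then (1:ℤ) else 0) * pR z z' (thirdPt z z'))
      = (∑ z : Pd k, ∑ z' : Pd k, (if TotDist z z' = true then (1:ℤ) else 0) * (ind A (glue (fun _ => 2) z) * (ind A' (glue (fun _ => 0) z) * ind U' z - ind A' (glue (fun _ => 0) z') * ind U' z')))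
        + (∑ z : Pd k, ∑ z' : Pd k, (if TotDist z z' = true then (1:ℤ) else 0) * (ind A (glue (fun _ => 2) z) * (ind A' (glue (fun _ => 1) z) * ind U' z - ind A' (glue (fun _ => 1) z') * ind U' z')))
        + (∑ z : Pd k, ∑ z' : Pd k, (if TotDist z z' = true then (1:ℤ) else 0) * (ind A' (glue (fun _ => 2) z) * (ind A (glue (fun _ => 0) z) * ind U' z - ind A (glue (fun _ => 0) z') * ind U' z')))
        + (∑ z : Pd k, ∑ z' : Pd k, (if TotDist z z' = true then (1:ℤ) else 0) * (ind A' (glue (fun _ => 2) z) * (ind A (glue (fun _ => 1) z) * ind U' z - ind A (glue (fun _ => 1) z') * ind U' z')))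
        + 2 * (∑ z : Pd k, ∑ z' : Pd k, (if TotDist z z' = true then (1:ℤ) else 0) * ((1 - ind U' z) * ind A (glue (fun _ => 2) z') * (ind A' (glue (fun _ => 2) z') - ind A' (glue (fun _ => 2) (thirdPt z z')))))
        - (∑ z : Pd k, ∑ z' : Pd k, (if TotDist z z' = true then (1:ℤ) else 0) * (ind A (glue (fun _ => 0) z) * ind A' (glue (fun _ => 1) z') * (ind U' z + ind U' z' - ind U' (thirdPt z z'))))
        - (∑ z : Pd k, ∑ z' : Pd k, (if TotDist z z' = true then (1:ℤ) else 0) * (ind A (glue (fun _ => 1) z) * ind A' (glue (fun _ => 0) z') * (ind U' z + ind U' z' - ind U' (thirdPt z z'))))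
        + (∑ z : Pd k, ∑ z' : Pd k, (if TotDist z z' = true then (1:ℤ) else 0) * (ind U' z * ((ind A (glue (fun _ => 2) z) - ind A (glue (fun _ => 0) z)) * (ind A' (glue (fun _ => 2) z) - ind A' (glue (fun _ => 0) z))
            + (ind A (glue (fun _ => 2) z) - ind A (glue (fun _ => 1) z)) * (ind A' (glue (fun _ => 2) z) - ind A' (glue (fun _ => 1) z)))))
        + (∑ z : Pd k, ∑ z' : Pd k, (if TotDist z z' = true then (1:ℤ) else 0) * ((1 - ind U' (thirdPt z z')) * ((ind A (glue (fun _ => 2) z) - ind A (glue (fun _ => 0) z)) * (ind A' (glue (fun _ => 2) z') - ind A' (glue (fun _ => 1) z'))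
            + (ind A (glue (fun _ => 2) z) - ind A (glue (fun _ => 1) z)) * (ind A' (glue (fun _ => 2) z') - ind A' (glue (fun _ => 0) z'))))) := by
    simp only [Finset.mul_sum, ← Finset.sum_add_distrib, ← Finset.sum_sub_distrib]
    refine Finset.sum_congr rfl fun z _ => Finset.sum_congr rfl fun z' _ => ?_
    simp only [hpR]
    ring
  -- left kernel = the explicit two-block sum minus the `2^k`-part of the single sum
  have k1 : (∑ z : Pd k, ∑ z' : Pd k, (if TotDist z z' = true then (1:ℤ) else 0) * pL z z' (thirdPt z z'))
      = (∑ z : Pd k, ∑ z' : Pd k, (if TotDist z z' = true then (1:ℤ) else 0) * pL6 z z' (thirdPt z z'))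
        - ∑ z : Pd k, ∑ z' : Pd k, (if TotDist z z' = true then (1:ℤ) else 0) * ((ind A (glue (fun _ => 0) z) * ind A' (glue (fun _ => 0) z) + ind A (glue (fun _ => 1) z) * ind A' (glue (fun _ => 1) z)) * ind U' z) := by
    rw [← Finset.sum_sub_distrib]
    refine Finset.sum_congr rfl fun z _ => ?_
    rw [← Finset.sum_sub_distrib]
    refine Finset.sum_congr rfl fun z' _ => ?_
    simp only [hpL, hpL6]
    ring
  have main : 0 ≤ (∑ z : Pd k, ∑ z' : Pd k, (if TotDist z z' = true then (1:ℤ) else 0) * pL6 z z' (thirdPt z z'))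
      + ∑ z : Pd k, (ind A (glue (fun _ => 0) z) * ind A' (glue (fun _ => 0) z) + ind A (glue (fun _ => 1) z) * ind A' (glue (fun _ => 1) z)) * (d' z - 2 ^ k * ind U' z) := by
    have h5 : (0:ℤ) ≤ 2 * (∑ z : Pd k, ∑ z' : Pd k, (if TotDist z z' = true then (1:ℤ) else 0) * ((1 - ind U' z) * ind A (glue (fun _ => 2) z') * (ind A' (glue (fun _ => 2) z') - ind A' (glue (fun _ => 2) (thirdPt z z'))))) :=
      mul_nonneg (by norm_num) F5
    linarith [k1, k2, k3, E2, F1, F2, F3, F4, F6, F7, T1, T2, T3]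
  refine le_of_le_of_eq main (congrArg₂ (· + ·) ?_ rfl)
  refine Finset.sum_congr rfl fun z _ => Finset.sum_congr rfl fun z' _ => ?_
  simp only [hpL6]
  ring

/-- **Condition (N) for the literal-absorption certificate.** [this work] -/
theorem litAbsorb_cert_N (ℓ : Pd 1) (hℓ : ℓ 0 = 2) {U' : Finset (Pd k)} (hU' : IsUpperSet (U' : Set (Pd k))) (d' : Pd k → ℤ)
    (hd' : ∀ z, 0 ≤ d' z)
    (hN' : ∀ P Q : Finset (Pd k), IsUpperSet (P : Set (Pd k)) → IsUpperSet (Q : Set (Pd k)) →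
      (∑ q ∈ P, ∑ r ∈ Q, thetaVal U' q r) ≤ ∑ z ∈ P ∩ Q, d' z)
    {X Y : Finset (Pd (1 + k))}
    (hX : ∀ ξ z, glue ξ z ∈ X ↔ ξ ∈ (univ.filter fun y : Pd 1 => ∀ j, ℓ j ≤ y j)) (hY : ∀ ξ z, glue ξ z ∈ Y ↔ z ∈ U') :
    ∀ A A' : Finset (Pd (1 + k)), IsUpperSet (A : Set (Pd (1 + k))) → IsUpperSet (A' : Set (Pd (1 + k))) →
      (∑ q ∈ A, ∑ r ∈ A', thetaVal (X ∪ Y) q r) ≤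
        ∑ x ∈ A ∩ A', ((2:ℤ) ^ (1 + k) * (ind X x + ind Y x) - ind X x * ((nuCount (X ∪ Y) x : ℤ) - nuCount X x)
        - ind X x * ind Y x * (nuCount X x : ℤ)
        + (1 - ind X x) * (d' (cellOf x) - 2 ^ k * ind U' (cellOf x))) :=
  litAbsorb_N_of_core d' hX hY (litAbsorb_core ℓ hℓ hU' d' hd' hN' hX hY)

/-- **LITERAL ABSORPTION** (every `k`, every `m`): if the up-set `U' ⊆ [3]^k` has a diagonal certificate `d'` (`d' ≥ 0`, (T), (N)), then the union
`U = {ξ = 2} × [3]^k ∪ [3] × U'` of a threshold-2 literal with the cylinder over `U'` satisfies `0 ≤ sStarD (U × [3]^m) B C` for all up-sets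
`B, C ⊆ [3]^{m+(1+k)}` — a good first slot of the pattern functional in every dimension. [this work] -/
theorem sStarD_cylSet_litAbsorb_nonneg {m : ℕ} (ℓ : Pd 1) (hℓ : ℓ 0 = 2) {U' : Finset (Pd k)} (hU' : IsUpperSet (U' : Set (Pd k)))
    (d' : Pd k → ℤ) (hd' : ∀ z, 0 ≤ d' z)
    (hT' : ∀ W : Finset (Pd k), IsUpperSet (W : Set (Pd k)) → (∑ z ∈ W, d' z) ≤ ∑ z ∈ W, lamU U' z)
    (hN' : ∀ P Q : Finset (Pd k), IsUpperSet (P : Set (Pd k)) → IsUpperSet (Q : Set (Pd k)) →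
      (∑ q ∈ P, ∑ r ∈ Q, thetaVal U' q r) ≤ ∑ z ∈ P ∩ Q, d' z)
    {X Y : Finset (Pd (1 + k))}
    (hX : ∀ ξ z, glue ξ z ∈ X ↔ ξ ∈ (univ.filter fun y : Pd 1 => ∀ j, ℓ j ≤ y j)) (hY : ∀ ξ z, glue ξ z ∈ Y ↔ z ∈ U')
    {B C : Finset (Pd (m + (1 + k)))} (hB : IsUpperSet (B : Set (Pd (m + (1 + k))))) (hC : IsUpperSet (C : Set (Pd (m + (1 + k))))) :
    0 ≤ sStarD (cylSet (X ∪ Y) : Finset (Pd (m + (1 + k)))) B C :=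
  sStarD_cylSet_nonneg_of_diagCert (X ∪ Y)
    (fun x => (2:ℤ) ^ (1 + k) * (ind X x + ind Y x) - ind X x * ((nuCount (X ∪ Y) x : ℤ) - nuCount X x)
        - ind X x * ind Y x * (nuCount X x : ℤ)
        + (1 - ind X x) * (d' (cellOf x) - 2 ^ k * ind U' (cellOf x)))
    (fun x => litAbsorb_cert_nonneg d' hd' hY x)
    (fun W hW => litAbsorb_cert_T ℓ hℓ d' hT' hX hY W hW)
    (litAbsorb_cert_N ℓ hℓ hU' d' hd' hN' hX hY) hB hC

/-! ### Corollary: the three-block star (two threshold-2 literals and an orthant) -/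

/-- **THE THREE-BLOCK STAR THEOREM** (every `k ≥ 1`, `b ∈ {1,2}^k`, every `m`): with `X₂ ∪ Y₂ = {t ≥ b} × [3] ∪ [3]^k × {p = 2} ⊆ [3]^{k+1}`
(the two-orthant union; certificate = pair certificate, valid by `…TwoOrthant`/`…TwoOrthantTop` and `pairCert_T`) and `X₃ ∪ Y₃ = {ξ = 2} × [3]^{k+1}
∪ [3] × (X₂ ∪ Y₂)`, the three-block star `{ξ = 2} ∪ {p = 2} ∪ {t ≥ b}` satisfies `0 ≤ sStarD ((X₃ ∪ Y₃) × [3]^m) B C` for all up-sets `B, C`: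
a good first slot in every dimension (literal absorption applied to the pair certificate). [this work] -/
theorem sStarD_cylSet_threeStar_nonneg {m : ℕ} (b : Pd k) (hb : (∃ i, b i = 2) ∨ (∀ i, b i = 1)) (hk : 0 < k) (ℓ : Pd 1) (hℓ : ℓ 0 = 2)
    {X₂ Y₂ : Finset (Pd (k + 1))} {X₃ Y₃ : Finset (Pd (1 + (k + 1)))}
    (hX₂ : ∀ t p, glue t p ∈ X₂ ↔ t ∈ (univ.filter fun x : Pd k => ∀ j, b j ≤ x j))
    (hY₂ : ∀ t p, glue t p ∈ Y₂ ↔ p ∈ (univ.filter fun y : Pd 1 => ∀ j, ℓ j ≤ y j))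
    (hX₃ : ∀ ξ z, glue ξ z ∈ X₃ ↔ ξ ∈ (univ.filter fun y : Pd 1 => ∀ j, ℓ j ≤ y j))
    (hY₃ : ∀ ξ z, glue ξ z ∈ Y₃ ↔ z ∈ X₂ ∪ Y₂)
    {B C : Finset (Pd (m + (1 + (k + 1))))} (hB : IsUpperSet (B : Set (Pd (m + (1 + (k + 1))))))
    (hC : IsUpperSet (C : Set (Pd (m + (1 + (k + 1)))))) :
    0 ≤ sStarD (cylSet (X₃ ∪ Y₃) : Finset (Pd (m + (1 + (k + 1))))) B C := by
  have hObup : IsUpperSet ((univ.filter fun x : Pd k => ∀ j, b j ≤ x j : Finset (Pd k)) : Set (Pd k)) := isUpperSet_filter_le b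
  have hLup : IsUpperSet (((univ.filter fun y : Pd 1 => ∀ j, ℓ j ≤ y j) : Finset (Pd 1)) : Set (Pd 1)) := isUpperSet_filter_le ℓ
  have hU'up : IsUpperSet ((X₂ ∪ Y₂ : Finset (Pd (k + 1))) : Set (Pd (k + 1))) := by
    rw [Finset.coe_union]
    refine IsUpperSet.union ?_ ?_
    · intro z z' hle hz
      rw [Finset.mem_coe] at hz ⊢
      rw [← glue_freeOf_cellOf z] at hz; rw [← glue_freeOf_cellOf z']
      rw [hX₂] at hz ⊢
      exact hObup (fun a => by simpa [freeOf] using hle (Fin.castAdd 1 a)) hz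
    · intro z z' hle hz
      rw [Finset.mem_coe] at hz ⊢
      rw [← glue_freeOf_cellOf z] at hz; rw [← glue_freeOf_cellOf z']
      rw [hY₂] at hz ⊢
      exact hLup (fun a => by simpa [cellOf] using hle (Fin.natAdd k a)) hz
  have hS := (show _ from
    match hb with
    | Or.inl hb2 => twoOrthant_hS_of_two b hb2 ℓ hX₂ hY₂
    | Or.inr hb1 => twoOrthant_hS_of_ones b hb1 hk ℓ hX₂ hY₂)
  exact sStarD_cylSet_litAbsorb_nonneg ℓ hℓ hU'up _ (fun z => pairCert_nonneg X₂ Y₂ z)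
    (fun W hW => pairCert_T hX₂ hY₂ hObup hLup W hW) (pairCert_N_of_sStarD_ge hX₂ hY₂ hS) hX₃ hY₃ hB hC

end Summit.CriticalPhenomena.PercolationContinuityZ3.Theorems.SahiGridPattern
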